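import Literature.Analysis.FluidPDE.TaoCascadeZeroScaleQuiet
import HarnessLib

/-!
# Tao's cascade ODE, §6.7: the early phase packaged — a uniform `c₀`-ceiling implies the quiescent bounds

T. Tao, *Finite time blowup for an averaged three-dimensional Navier–Stokes equation*,
J. Amer. Math. Soc. **29** (2016), 601–674 = arXiv:1402.0290v3, §6.7, (6.147)–(6.151): the chain
"(6.148) `|c₀|` small on `[0, ½]` ⟹ (6.149)–(6.150) `|d₀|, |a₁| = O(K^{-10})`, `a₀ ≥ 0` ⟹ (6.151)
`∂ₜẼ₋₁ ≤ O(K^{-14})`" which rules out the exits (6.126)–(6.127) up to time `½` ("`T₂ ≥ 1/2`").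

`RescaledHypotheses.early_regime_bounds` packages this chain over the hypotheses of Prop. 6.5
(`RescaledHypotheses γ …`, `TaoCascadeRescaled.lean`) on a bootstrap interval `[0, T]` with pointwise
regime bounds, in terms of a **ceiling `C⋆` for `|c₀|`**: the explicit bound of
`RescaledHypotheses.early_c_abs_le` (`TaoCascadeZeroScaleEarly.lean`) at time `T`, with the initial
values bounded by `TaoCascadeZeroScaleInit.lean`, is
`C(T) = exp(ε⁻¹K^{10}((10⁻⁵ε + γε²)T + (2√2ε + √2η)T²/2))·(γε² + (2ε²e^{-K^{10}} + η)T)`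
(`η = C₁(1+ε₀)^{-n₀/2}`); assuming `C(T) ≤ C⋆` the conclusions are the uniform bounds
`|c₀| ≤ C⋆`, `√(d₀²+a₁²) ≤ D(T, C⋆)` (explicit), `|a₀ - 1| ≤ drift(C⋆, D)·T`, `a₀ ≥ 0` and the slow
variation of `Ẽ₋₁` when `drift·T ≤ 1`, and `∫₀ᵗ a₁² ≤ D² t`. Choosing `T = ½` and `C⋆ = K^{-10}ε²`
(legitimate for `γ ≤ 10⁻⁵e^{-K^{10}/2}`, `K` large, `ε` small, `n₀` large) gives the source's
statement; the parameter hierarchy is left to the assembler.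

## References

* T. Tao, J. Amer. Math. Soc. 29 (2016), 601–674, arXiv:1402.0290v3, §6.7 (6.147)–(6.151).
  [`Tao2016AveragedNS`]
-/

noncomputable section

open Set MeasureTheory intervalIntegral

namespace Literature.Analysis.FluidPDE

namespace TaoCascade

open Literature.Analysis.ODE

section EarlyRegime

variable {γ ε₀ K ε C₁ C₂ C₃ : ℝ} {n₀ N : ℤ} {τ : ℤ → ℝ} {Xr : Fin 4 → ℤ → ℝ → ℝ} {Er : ℤ → ℝ → ℝ}

/-- **A uniform ceiling for `|c₀|` on `[0, T]` from (6.148) and the initial data**: if the explicit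
bound `C(T)` of the module docstring is `≤ C⋆`, then `|c₀(t)| ≤ C⋆` on `[0, T]` (`0 < ε ≤ 1`, `γ ≥ 0`).
[cite: Tao2016AveragedNS, §6.7 (6.148)] -/
theorem RescaledHypotheses.early_c_ceiling
    (h : RescaledHypotheses γ ε₀ K ε C₁ C₂ C₃ n₀ N τ Xr Er) (hε : 0 < ε) (hε1 : ε ≤ 1) (hC₁ : 0 ≤ C₁)
    (hε₀ : 0 < ε₀) (hN : n₀ ≤ N) (hγ : 0 ≤ γ) {T Cstar : ℝ}
    (hreg : ∀ t ∈ Icc 0 T, Er 0 t ≤ 1)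
    (hC : Real.exp (|ε⁻¹ * K ^ 10| * ((1 / 10 ^ 5 * ε + γ * ε ^ 2) * T +
        (Real.sqrt 2 * ε * Real.sqrt 2 ^ 2 + Real.sqrt 2 * (C₁ * (1 + ε₀) ^ (-((n₀ : ℝ) / 2)))) *
          T ^ 2 / 2)) *
        (γ * ε ^ 2 + (|ε ^ 2 * Real.exp (-K ^ 10)| * 2 + C₁ * (1 + ε₀) ^ (-((n₀ : ℝ) / 2))) * T) ≤ Cstar)
    {t : ℝ} (ht : t ∈ Icc 0 T) : |Xr 2 0 t| ≤ Cstar := by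
  have hτ0 : τ (n₀ - N) ≤ 0 := h.tau_le _ le_rfl (by omega)
  have hq0 : (0 : ℝ) < 1 + ε₀ := by linarith
  have hη : 0 ≤ C₁ * (1 + ε₀) ^ (-((n₀ : ℝ) / 2)) := mul_nonneg hC₁ (Real.rpow_nonneg hq0.le _)
  have hb := h.early_c_abs_le hε hε1 hC₁ hε₀ hτ0 hreg ht
  have hW := h.sqrt_bc_zero_le hγ hε.le
  have hc0 : |Xr 2 0 0| ≤ γ * ε ^ 2 := h.c_abs_le
  have hσ : 0 ≤ Real.sqrt 2 * ε * Real.sqrt 2 ^ 2 + Real.sqrt 2 * (C₁ * (1 + ε₀) ^ (-((n₀ : ℝ) / 2))) := by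
    positivity
  have hsrc : 0 ≤ |ε ^ 2 * Real.exp (-K ^ 10)| * 2 + C₁ * (1 + ε₀) ^ (-((n₀ : ℝ) / 2)) := by positivity
  -- monotonicity in `t ≤ T` and in the initial values
  have hexp : Real.exp (|ε⁻¹ * K ^ 10| * (Real.sqrt (Xr 1 0 0 ^ 2 + Xr 2 0 0 ^ 2) * t +
      (Real.sqrt 2 * ε * Real.sqrt 2 ^ 2 + Real.sqrt 2 * (C₁ * (1 + ε₀) ^ (-((n₀ : ℝ) / 2)))) *
        t ^ 2 / 2)) ≤
      Real.exp (|ε⁻¹ * K ^ 10| * ((1 / 10 ^ 5 * ε + γ * ε ^ 2) * T +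
        (Real.sqrt 2 * ε * Real.sqrt 2 ^ 2 + Real.sqrt 2 * (C₁ * (1 + ε₀) ^ (-((n₀ : ℝ) / 2)))) *
          T ^ 2 / 2)) := by
    apply Real.exp_le_exp.2
    apply mul_le_mul_of_nonneg_left _ (abs_nonneg _)
    have h1 : Real.sqrt (Xr 1 0 0 ^ 2 + Xr 2 0 0 ^ 2) * t ≤ (1 / 10 ^ 5 * ε + γ * ε ^ 2) * T :=
      mul_le_mul hW ht.2 ht.1 (by positivity)
    have h2 : t ^ 2 ≤ T ^ 2 := pow_le_pow_left₀ ht.1 ht.2 2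
    have h3 := mul_le_mul_of_nonneg_left h2 hσ
    linarith
  have hfac : |Xr 2 0 0| + (|ε ^ 2 * Real.exp (-K ^ 10)| * 2 + C₁ * (1 + ε₀) ^ (-((n₀ : ℝ) / 2))) * t ≤
      γ * ε ^ 2 + (|ε ^ 2 * Real.exp (-K ^ 10)| * 2 + C₁ * (1 + ε₀) ^ (-((n₀ : ℝ) / 2))) * T := by
    have := mul_le_mul_of_nonneg_left ht.2 hsrc
    linarith
  have hfac0 : 0 ≤ |Xr 2 0 0| + (|ε ^ 2 * Real.exp (-K ^ 10)| * 2 + C₁ * (1 + ε₀) ^ (-((n₀ : ℝ) / 2))) * t := by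
    have := mul_nonneg hsrc ht.1; positivity
  calc |Xr 2 0 t| ≤ _ := hb
    _ ≤ Real.exp (|ε⁻¹ * K ^ 10| * ((1 / 10 ^ 5 * ε + γ * ε ^ 2) * T +
          (Real.sqrt 2 * ε * Real.sqrt 2 ^ 2 + Real.sqrt 2 * (C₁ * (1 + ε₀) ^ (-((n₀ : ℝ) / 2)))) *
            T ^ 2 / 2)) *
        (γ * ε ^ 2 + (|ε ^ 2 * Real.exp (-K ^ 10)| * 2 + C₁ * (1 + ε₀) ^ (-((n₀ : ℝ) / 2))) * T) :=
        mul_le_mul hexp hfac hfac0 (Real.exp_pos _).le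
    _ ≤ Cstar := hC

/-- **The early phase, packaged** ((6.148)–(6.151)). On `[0, T]` (`0 ≤ T`) with the regime bounds
`Ẽ₀, Ẽ₁ ≤ 1`, `Ẽ₋₁ ≤ E₋`, `Ẽ₋₂ ≤ E₂`, the secondary bounds `|b₁| ≤ B_b`, `|c₁| ≤ B_c`, `|d₁| ≤ B_d`
and a ceiling `|c₀| ≤ C⋆` (e.g. from `early_c_ceiling`), writing
`D := e^{νT}(K^{-10} + √2K^{-15} + (ε⁻²√2C⋆ + η + η₃)T)` (`ν = (1+ε₀)^{5/2}(εB_b + ε²e^{-K^{10}}B_c)`,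
`η = C₁(1+ε₀)^{-n₀/2}`, `η₃ = (1+ε₀)^{5/2}ε⁻²B_cB_d + C₁(1+ε₀)^{2-n₀/2}`) and
`drift := ε⁻²C⋆D + 2ε + 2ε²e^{-K^{10}} + 2KE₋ + η`, one has for all `t ∈ [0, T]`:
`|d₀(t)|, |a₁(t)| ≤ D`, `|a₀(t) - 1| ≤ drift·T`, `∫₀ᵗ a₁² ≤ D²t`, and, if `drift·T ≤ 1`, `a₀(t) ≥ 0`
and `Ẽ₋₁(t) ≤ Ẽ₋₁(0) + 2K(1+ε₀)^{-5/2}E₂√(2E₋)·T`. [cite: Tao2016AveragedNS, §6.7 (6.149)–(6.151)] -/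
theorem RescaledHypotheses.early_regime_bounds
    (h : RescaledHypotheses γ ε₀ K ε C₁ C₂ C₃ n₀ N τ Xr Er) (hε : 0 < ε) (hK : 0 < K) (hC₁ : 0 ≤ C₁)
    (hε₀ : 0 < ε₀) (hN : n₀ ≤ N) {T Em E₂ Bb Bc Bd Cstar : ℝ} (hT : 0 ≤ T)
    (hreg : ∀ t ∈ Icc 0 T, Er 0 t ≤ 1 ∧ Er 1 t ≤ 1 ∧ Er (-1) t ≤ Em ∧ Er (-2) t ≤ E₂)
    (hsec : ∀ t ∈ Icc 0 T, |Xr 1 1 t| ≤ Bb ∧ |Xr 2 1 t| ≤ Bc ∧ |Xr 3 1 t| ≤ Bd)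
    (hc : ∀ t ∈ Icc 0 T, |Xr 2 0 t| ≤ Cstar) :
    let D : ℝ := Real.exp ((1 + ε₀) ^ ((5 : ℝ) / 2) * (ε * Bb + ε ^ 2 * Real.exp (-K ^ 10) * Bc) * T) *
        ((K ^ 10)⁻¹ + Real.sqrt 2 * (K ^ 15)⁻¹ +
          ((ε ^ 2)⁻¹ * Real.sqrt 2 * Cstar + C₁ * (1 + ε₀) ^ (-((n₀ : ℝ) / 2)) +
            ((1 + ε₀) ^ ((5 : ℝ) / 2) * (ε ^ 2)⁻¹ * Bc * Bd + C₁ * (1 + ε₀) ^ (2 - (n₀ : ℝ) / 2))) * T)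
    let drift : ℝ := (ε ^ 2)⁻¹ * Cstar * D +
        (2 * ε + 2 * ε ^ 2 * Real.exp (-K ^ 10) + 2 * K * Em + C₁ * (1 + ε₀) ^ (-((n₀ : ℝ) / 2)))
    (∀ t ∈ Icc 0 T, |Xr 3 0 t| ≤ D ∧ |Xr 0 1 t| ≤ D) ∧
      (∀ t ∈ Icc 0 T, |Xr 0 0 t - 1| ≤ drift * T) ∧
      (∀ t ∈ Icc 0 T, ∫ s in (0 : ℝ)..t, Xr 0 1 s ^ 2 ≤ D ^ 2 * t) ∧
      (drift * T ≤ 1 →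
        (∀ t ∈ Icc 0 T, 0 ≤ Xr 0 0 t) ∧
          ∀ t ∈ Icc 0 T, Er (-1) t ≤ Er (-1) 0 +
            2 * K * (1 + ε₀) ^ (-((5 : ℝ) / 2)) * E₂ * Real.sqrt (2 * Em) * T) := by
  intro D drift
  have hτ0 : τ (n₀ - N) ≤ 0 := h.tau_le _ le_rfl (by omega)
  have hreg01 : ∀ t ∈ Icc 0 T, Er 0 t ≤ 1 ∧ Er 1 t ≤ 1 := fun t ht => ⟨(hreg t ht).1, (hreg t ht).2.1⟩
  -- (6.149): `|d₀|, |a₁| ≤ D`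
  have hD : ∀ t ∈ Icc 0 T, |Xr 3 0 t| ≤ D ∧ |Xr 0 1 t| ≤ D := by
    intro t ht
    have hsq := h.quiet_da_le hε hC₁ hε₀ hK hN hT hreg01 hsec hc ht
    have hxy := abs_le_sqrt_sq_add_sq (Xr 3 0 t) (Xr 0 1 t)
    exact ⟨hxy.1.trans hsq, hxy.2.trans hsq⟩
  -- (6.150)/(6.156): `|a₀ - 1| ≤ drift T`
  have hregm : ∀ t ∈ Icc 0 T, Er 0 t ≤ 1 ∧ Er (-1) t ≤ Em := fun t ht => ⟨(hreg t ht).1, (hreg t ht).2.2.1⟩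
  have hcd : ∀ t ∈ Icc 0 T, |Xr 2 0 t| ≤ Cstar ∧ |Xr 3 0 t| ≤ D := fun t ht => ⟨hc t ht, (hD t ht).1⟩
  have hA : ∀ t ∈ Icc 0 T, |Xr 0 0 t - 1| ≤ drift * T ∧ (drift * T ≤ 1 → 0 ≤ Xr 0 0 t) := fun t ht =>
    h.quiet_a_sub_one_le hε hK.le hC₁ hε₀ hN hT hregm hcd ht
  refine ⟨hD, fun t ht => (hA t ht).1, fun t ht => h.integral_a_one_sq_le hτ0 (fun s hs => (hD s hs).2) ht,
    fun hsmall => ⟨fun t ht => (hA t ht).2 hsmall, fun t ht => ?_⟩⟩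
  have hregm2 : ∀ t ∈ Icc 0 T, Er (-1) t ≤ Em ∧ Er (-2) t ≤ E₂ := fun t ht =>
    ⟨(hreg t ht).2.2.1, (hreg t ht).2.2.2⟩
  exact h.quiet_neg_one_energy_le hK.le hε₀ hN hT hregm2 (fun s hs => (hA s hs).2 hsmall) ht

end EarlyRegime

end TaoCascade

end Literature.Analysis.FluidPDE
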